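import Mathlib
import HarnessLib
import Summits.HubbardSuperconductivity.HubbardSuperconductivity.Theorems.KLProgrammeC4aZoneThresholdsCapped
import Summits.HubbardSuperconductivity.HubbardSuperconductivity.Theorems.KLProgrammeC4aPathComparability

/-!
# Route `KLProgramme` — crux C4a, (U1) «(T)-MARGIN-PERTURBATIVE»: NON-VACUITY OF THE PERTURBATIVE HEADLINE — for EVERY tangency margin `ϑ_T > 0` and Cooper margin
# `ϑ_C > 0` the 17 zone rows, the perturbative tangency row and the Cooper row are met at once by `n`-free thresholds

Cell `gate-hubbard-kl`, seat hubbard-kl-k3c3-p3 (g35; row «implicit-function / monotonicity route for μ(n)»).  Helper for stub (C) `stub_twoLeg_curvature` of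
`KLRegimeEngineV17F2` (stmt-HubbardSuperconductivity-20437); pen (R383) «(T)-MARGIN-A»; memo HOME/hubbard-kl-k3c3-p3/U1-CAUSTIC-SUP.md §18.

WHY.  `loopCircle_twoArcs_integral[_middle]_le_canonical_perturbative` (`…C4aLoopCircleCanonicalPerturbative[Middle]`) carries, besides the 17 smallness rows certified
jointly feasible by `…C4aZoneThresholds.exists_zoneThresholds` (p698922), the two MARGIN rows
`10³(|ρ|/2 + 5ρ²/2 + K_cτ₀/2) < ((2u_min/π)ϑ_T)²` (tangency, `…C4aDirectSheetExclusion`) and `C(λ,ε) < pairSumLowerConst r·ϑ_C` (Cooper).  With the ADDITIVE-SLACK margin of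
the g34 headline the tangency row forced `ϑ_T ≳ √A/u_min` whatever the thresholds; here BOTH margins are free: given any `ϑ_T, ϑ_C > 0`, run p698922's construction with
the caps `τ₀ ≤ min(pairSumLowerConst r·ϑ_C/2, M/(4(K_c+1)))`, `ρ_C ≤ min(M/4, 1/10)`, `M := ((2u_min/π)ϑ_T)²/10³` (`…C4aZoneThresholdsCapped.exists_zoneThresholds_capped`);
then `|ρ|/2 + 5ρ²/2 + K_cτ₀/2 ≤ M/8 + M/16 + M/8 < M` and `C(λ,ε) = T(λ,ε,hi) − 2hi/d ≤ τ₀ ≤ pairSumLowerConst r·ϑ_C/2` (row 17).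
* **`exists_zoneThresholds_margins`** (HEADLINE): p698922's 27 constant facts and, for all `0 ≤ ℓ ≤ ℓ₀`, `0 < hi ≤ hi₀`, `|ρ| ≤ ρ_C`, `0 ≤ L_w ≤ L`, the 17 rows PLUS the
  two margin rows LITERALLY as the perturbative headline reads them — the excluded tangency and Cooper neighbourhoods may be taken as small as one likes.
Elementary real arithmetic; nothing asserts (C), K3, the window or superconductivity.
References: FST II CPAM 51 (1998) §3 [cite: FeldmanSalmhoferTrubowitz1998]; BGM 2003 §7.1 [cite: BenfattoGiulianiMastropietro2003].
-/

noncomputable section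

namespace Summit.HubbardSuperconductivity.HubbardSuperconductivity.Theorems.C4a

set_option linter.dupNamespace false -- summit = problem name (single-conjunct summit), D-0017

open Real Set
open Literature.MathematicalPhysics.QuantumLattice Literature.MathematicalPhysics.QuantumLattice.BandSectorCounting
open Literature.MathematicalPhysics.QuantumLattice.FermiRG
open Summit.HubbardSuperconductivity.HubbardSuperconductivity.Theorems.KLRegimeSplit
open Summit.HubbardSuperconductivity.HubbardSuperconductivity.Theorems.DispersionFlow
open Summit.HubbardSuperconductivity.HubbardSuperconductivity.Theorems.PerturbedFermiCurve

section Sizes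

variable {K : TrigPolyC4v} {A : ℝ} (hA : ∀ p : Momentum, ∀ j ≤ 2, ‖iteratedFDeriv ℝ j (frameShift K) p‖ ≤ A) (hA20 : A ≤ 1 / 20)
  (hd : klCurveD ≤ (bandBounds (show (-4 : ℝ) < -1.1 by norm_num) (show (-1.1 : ℝ) ≤ -0.1 by norm_num)
    (show (-0.1 : ℝ) < 0 by norm_num)).Dtmin - 2 * A)
  {μ r : ℝ} (hr : 0 < r) (hlo : (-1.1 : ℝ) < μ - r - A) (hhi : μ + r + A < -0.1)
  {A₃ A₄ : ℝ} (hA₃ : ∀ p : Momentum, ‖iteratedFDeriv ℝ 3 (frameShift K) p‖ ≤ A₃)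
  (hA₄ : ∀ p : Momentum, ‖iteratedFDeriv ℝ 4 (frameShift K) p‖ ≤ A₄)
  {K₁ K₂ K₃ : ℝ} (hK₁ : ∀ p : Momentum, ‖fderiv ℝ (frameLevel μ K) p‖ ≤ K₁) (hK₂ : ∀ p : Momentum, ‖iteratedFDeriv ℝ 2 (frameLevel μ K) p‖ ≤ K₂)
  (hK₃ : ∀ p : Momentum, ‖iteratedFDeriv ℝ 3 (frameLevel μ K) p‖ ≤ K₃)
include hA hA20 hd hr hlo hhi hA₃ hA₄ hK₁ hK₂ hK₃

set_option maxHeartbeats 400000 in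
/-- **THE PERTURBATIVE HEADLINE'S THRESHOLD ROWS ARE JOINTLY FEASIBLE FOR EVERY PAIR OF MARGINS** (HEADLINE; see the module docstring). -/
theorem exists_zoneThresholds_margins {w Kc K₀ r₀ : ℝ} (hw : 0 < w) (hKc : 0 ≤ Kc) (hK₀ : 0 < K₀) (hr₀ : 0 < r₀) {ϑT ϑC : ℝ} (hϑT : 0 < ϑT)
    (hϑC : 0 < ϑC) :
    ∃ ℓ₀ L Wm Wφ τ₀ Δ Δc ω η₀ d₁ lam eps hi₀ ρC Γ Γ' : ℝ,
      0 < ℓ₀ ∧ 0 < L ∧ 0 < Wm ∧ 0 < Wφ ∧ 0 < τ₀ ∧ 0 < Δ ∧ 0 < Δc ∧ 0 < ω ∧ 0 < η₀ ∧ 0 < d₁ ∧ 0 < lam ∧ 0 < eps ∧ 0 < hi₀ ∧ 0 < ρC ∧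
      ρC < r ∧ ρC < 3 / 80 ∧ hi₀ < r ∧ hi₀ < r₀ ∧ hi₀ ≤ K₀ ∧ Δ ≤ 3 / 10 ∧ Δ ≤ (bandBounds (show (-4 : ℝ) < -1.1 by norm_num) (show (-1.1 : ℝ) ≤ -0.1 by norm_num) (show (-0.1 : ℝ) < 0 by norm_num)).umin ∧ K₁ * Δ < r ∧ Δc ≤ 3 / 10 ∧ K₁ * Δc < r ∧ eps ≤ r ∧
      K₀ ≤ Γ ∧ K₀ ≤ Γ' ∧
      ∀ ℓ hi ρ Lw : ℝ, 0 ≤ ℓ → ℓ ≤ ℓ₀ → 0 < hi → hi ≤ hi₀ → |ρ| ≤ ρC → 0 ≤ Lw → Lw ≤ L →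
        Lw + 2 * Wm ≤ Wφ ∧
        K₃ * (τ₀ + msD A₃ A₄ 1 * (ℓ) +
              hi / ((bandBounds (show (-4 : ℝ) < -1.1 by norm_num) (show (-1.1 : ℝ) ≤ -0.1 by norm_num) (show (-0.1 : ℝ) < 0 by norm_num)).Dtmin - 2 * A) +
              msD A₃ A₄ 1 * Wφ) * msD A₃ A₄ 1 ^ 2 +
          K₂ * (radialRowOneConst A ((bandBounds (show (-4 : ℝ) < -1.1 by norm_num) (show (-1.1 : ℝ) ≤ -0.1 by norm_num) (show (-0.1 : ℝ) < 0 by norm_num)).Dtmin -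
                2 * A) * hi + msD A₃ A₄ 2 * Wφ) * (msD A₃ A₄ 1 + msD A₃ A₄ 1) +
          K₂ * (τ₀ + msD A₃ A₄ 1 * (ℓ) +
              hi / ((bandBounds (show (-4 : ℝ) < -1.1 by norm_num) (show (-1.1 : ℝ) ≤ -0.1 by norm_num) (show (-0.1 : ℝ) < 0 by norm_num)).Dtmin - 2 * A) +
              msD A₃ A₄ 1 * Wφ) * msD A₃ A₄ 2 +
          K₁ * ((uRowTwoConst A A₃ ((bandBounds (show (-4 : ℝ) < -1.1 by norm_num) (show (-1.1 : ℝ) ≤ -0.1 by norm_num) (show (-0.1 : ℝ) < 0 by norm_num)).Dtmin -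
                  2 * A) +
                1 / ((bandBounds (show (-4 : ℝ) < -1.1 by norm_num) (show (-1.1 : ℝ) ≤ -0.1 by norm_num) (show (-0.1 : ℝ) < 0 by norm_num)).Dtmin - 2 * A) +
                2 * (radialRowOneConst A ((bandBounds (show (-4 : ℝ) < -1.1 by norm_num) (show (-1.1 : ℝ) ≤ -0.1 by norm_num)
                    (show (-0.1 : ℝ) < 0 by norm_num)).Dtmin - 2 * A) -
                  1 / ((bandBounds (show (-4 : ℝ) < -1.1 by norm_num) (show (-1.1 : ℝ) ≤ -0.1 by norm_num) (show (-0.1 : ℝ) < 0 by norm_num)).Dtmin - 2 * A))) *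
              hi + msD A₃ A₄ 3 * Wφ) ≤
        w * (bandBounds (show (-4 : ℝ) < -1.1 by norm_num) (show (-1.1 : ℝ) ≤ -0.1 by norm_num) (show (-0.1 : ℝ) < 0 by norm_num)).umin ^ 2 ∧
        K₂ * msD A₃ A₄ 1 * (τ₀ + msD A₃ A₄ 1 * (ℓ) +
        2 * (hi / ((bandBounds (show (-4 : ℝ) < -1.1 by norm_num) (show (-1.1 : ℝ) ≤ -0.1 by norm_num) (show (-0.1 : ℝ) < 0 by norm_num)).Dtmin - 2 * A))) ≤
      w * (bandBounds (show (-4 : ℝ) < -1.1 by norm_num) (show (-1.1 : ℝ) ≤ -0.1 by norm_num) (show (-0.1 : ℝ) < 0 by norm_num)).umin ^ 2 * Wm ∧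
        K₂ * (τ₀ + msD A₃ A₄ 1 * (ℓ) +
          2 * (hi / ((bandBounds (show (-4 : ℝ) < -1.1 by norm_num) (show (-1.1 : ℝ) ≤ -0.1 by norm_num) (show (-0.1 : ℝ) < 0 by norm_num)).Dtmin - 2 * A) +
            msD A₃ A₄ 1 * Wφ)) /
        ((bandBounds (show (-4 : ℝ) < -1.1 by norm_num) (show (-1.1 : ℝ) ≤ -0.1 by norm_num) (show (-0.1 : ℝ) < 0 by norm_num)).Dtmin - 2 * A) ≤ 1 / 2 ∧
        hi / 2 ≤ Γ ∧ w * (bandBounds (show (-4 : ℝ) < -1.1 by norm_num) (show (-1.1 : ℝ) ≤ -0.1 by norm_num) (show (-0.1 : ℝ) < 0 by norm_num)).umin ^ 2 / 2 * (Lw + 2 * Wm) ^ 2 ≤ Γ' ∧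
        τ₀ + msD A₃ A₄ 1 * (ℓ) + 2 * (msD A₃ A₄ 1 * Wφ) ≤ Δ ∧
        τ₀ + 2 * (msD A₃ A₄ 1 * η₀ + |ρ| / ((bandBounds (show (-4 : ℝ) < -1.1 by norm_num) (show (-1.1 : ℝ) ≤ -0.1 by norm_num) (show (-0.1 : ℝ) < 0 by norm_num)).Dtmin - 2 * A)) ≤ 3 / 5 ∧
        τ₀ + msD A₃ A₄ 1 * ((ℓ) + (Lw + 2 * Wm)) ≤ Δc ∧ η₀ + (ℓ) ≤ ω ∧ Lw + 2 * Wm ≤ ω ∧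
        0 < 2 / π * (((bandBounds (show (-4 : ℝ) < -1.1 by norm_num) (show (-1.1 : ℝ) ≤ -0.1 by norm_num) (show (-0.1 : ℝ) < 0 by norm_num)).Dtmin - 2 * A) * (bandBounds (show (-4 : ℝ) < -1.1 by norm_num) (show (-1.1 : ℝ) ≤ -0.1 by norm_num) (show (-0.1 : ℝ) < 0 by norm_num)).umin) *
      ((bandBounds (show (-4 : ℝ) < -1.1 by norm_num) (show (-1.1 : ℝ) ≤ -0.1 by norm_num) (show (-0.1 : ℝ) < 0 by norm_num)).umin * (3 / 200) / (4 + 2 * A) * (η₀ - (ℓ) - π / (2 * (bandBounds (show (-4 : ℝ) < -1.1 by norm_num) (show (-1.1 : ℝ) ≤ -0.1 by norm_num) (show (-0.1 : ℝ) < 0 by norm_num)).umin) * Δc) - π * 7 * (K₁ * Δc + |ρ|) / ((bandBounds (show (-4 : ℝ) < -1.1 by norm_num) (show (-1.1 : ℝ) ≤ -0.1 by norm_num) (show (-0.1 : ℝ) < 0 by norm_num)).Dtmin - 2 * A) ^ 2) ∧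
        2 / π * (((bandBounds (show (-4 : ℝ) < -1.1 by norm_num) (show (-1.1 : ℝ) ≤ -0.1 by norm_num) (show (-0.1 : ℝ) < 0 by norm_num)).Dtmin - 2 * A) * (bandBounds (show (-4 : ℝ) < -1.1 by norm_num) (show (-1.1 : ℝ) ≤ -0.1 by norm_num) (show (-0.1 : ℝ) < 0 by norm_num)).umin) *
      ((bandBounds (show (-4 : ℝ) < -1.1 by norm_num) (show (-1.1 : ℝ) ≤ -0.1 by norm_num) (show (-0.1 : ℝ) < 0 by norm_num)).umin * (3 / 200) / (4 + 2 * A) * (η₀ - (ℓ) - π / (2 * (bandBounds (show (-4 : ℝ) < -1.1 by norm_num) (show (-1.1 : ℝ) ≤ -0.1 by norm_num) (show (-0.1 : ℝ) < 0 by norm_num)).umin) * Δc) - π * 7 * (K₁ * Δc + |ρ|) / ((bandBounds (show (-4 : ℝ) < -1.1 by norm_num) (show (-1.1 : ℝ) ≤ -0.1 by norm_num) (show (-0.1 : ℝ) < 0 by norm_num)).Dtmin - 2 * A) ^ 2) * (ℓ) ≤ Γ ∧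
        2 * (2 * K₃ * Δc * msD A₃ A₄ 1 ^ 2 +
        4 * K₂ * (radialRowOneConst A ((bandBounds (show (-4 : ℝ) < -1.1 by norm_num) (show (-1.1 : ℝ) ≤ -0.1 by norm_num) (show (-0.1 : ℝ) < 0 by norm_num)).Dtmin - 2 * A) * |ρ| + msD A₃ A₄ 2 * ω) * msD A₃ A₄ 1 +
        K₂ * Δc * msD A₃ A₄ 2 +
        K₁ * ((uRowTwoConst A A₃ ((bandBounds (show (-4 : ℝ) < -1.1 by norm_num) (show (-1.1 : ℝ) ≤ -0.1 by norm_num) (show (-0.1 : ℝ) < 0 by norm_num)).Dtmin - 2 * A) + 1 / ((bandBounds (show (-4 : ℝ) < -1.1 by norm_num) (show (-1.1 : ℝ) ≤ -0.1 by norm_num) (show (-0.1 : ℝ) < 0 by norm_num)).Dtmin - 2 * A) +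
              2 * (radialRowOneConst A ((bandBounds (show (-4 : ℝ) < -1.1 by norm_num) (show (-1.1 : ℝ) ≤ -0.1 by norm_num) (show (-0.1 : ℝ) < 0 by norm_num)).Dtmin - 2 * A) - 1 / ((bandBounds (show (-4 : ℝ) < -1.1 by norm_num) (show (-1.1 : ℝ) ≤ -0.1 by norm_num) (show (-0.1 : ℝ) < 0 by norm_num)).Dtmin - 2 * A))) * |ρ| + msD A₃ A₄ 3 * ω)) < 9 / 400 * (bandBounds (show (-4 : ℝ) < -1.1 by norm_num) (show (-1.1 : ℝ) ≤ -0.1 by norm_num) (show (-0.1 : ℝ) < 0 by norm_num)).umin ^ 2 ∧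
        K₁ * (hi / ((bandBounds (show (-4 : ℝ) < -1.1 by norm_num) (show (-1.1 : ℝ) ≤ -0.1 by norm_num) (show (-0.1 : ℝ) < 0 by norm_num)).Dtmin - 2 * A)) ≤ d₁ / 2 ∧
        d₁ + K₁ * (msD A₃ A₄ 1 * (Lw)) + K₁ * (hi / ((bandBounds (show (-4 : ℝ) < -1.1 by norm_num) (show (-1.1 : ℝ) ≤ -0.1 by norm_num) (show (-0.1 : ℝ) < 0 by norm_num)).Dtmin - 2 * A)) + hi ≤ eps ∧
        msD A₃ A₄ 1 *
            ((π / 2 * lam /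
                  (((bandBounds (show (-4 : ℝ) < -1.1 by norm_num) (show (-1.1 : ℝ) ≤ -0.1 by norm_num) (show (-0.1 : ℝ) < 0 by norm_num)).Dtmin -
                      2 * A) *
                    (bandBounds (show (-4 : ℝ) < -1.1 by norm_num) (show (-1.1 : ℝ) ≤ -0.1 by norm_num) (show (-0.1 : ℝ) < 0 by norm_num)).umin) +
                π * Kc * eps / ((bandBounds (show (-4 : ℝ) < -1.1 by norm_num) (show (-1.1 : ℝ) ≤ -0.1 by norm_num) (show (-0.1 : ℝ) < 0 by norm_num)).Dtmin - 2 * A) ^ 2) /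
              ((bandBounds (show (-4 : ℝ) < -1.1 by norm_num) (show (-1.1 : ℝ) ≤ -0.1 by norm_num) (show (-0.1 : ℝ) < 0 by norm_num)).umin * w /
                (4 + 2 * A))) +
          (2 * hi + eps) / ((bandBounds (show (-4 : ℝ) < -1.1 by norm_num) (show (-1.1 : ℝ) ≤ -0.1 by norm_num) (show (-0.1 : ℝ) < 0 by norm_num)).Dtmin -
            2 * A) ≤ τ₀ ∧
        1000 * (|ρ| / 2 + 5 / 2 * ρ ^ 2 + Kc * τ₀ / 2) < (2 * (bandBounds (show (-4 : ℝ) < -1.1 by norm_num) (show (-1.1 : ℝ) ≤ -0.1 by norm_num) (show (-0.1 : ℝ) < 0 by norm_num)).umin / π * ϑT) ^ 2 ∧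
        msD A₃ A₄ 1 *
            ((π / 2 * lam /
                  (((bandBounds (show (-4 : ℝ) < -1.1 by norm_num) (show (-1.1 : ℝ) ≤ -0.1 by norm_num) (show (-0.1 : ℝ) < 0 by norm_num)).Dtmin -
                      2 * A) *
                    (bandBounds (show (-4 : ℝ) < -1.1 by norm_num) (show (-1.1 : ℝ) ≤ -0.1 by norm_num) (show (-0.1 : ℝ) < 0 by norm_num)).umin) +
                π * Kc * eps / ((bandBounds (show (-4 : ℝ) < -1.1 by norm_num) (show (-1.1 : ℝ) ≤ -0.1 by norm_num) (show (-0.1 : ℝ) < 0 by norm_num)).Dtmin - 2 * A) ^ 2) /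
              ((bandBounds (show (-4 : ℝ) < -1.1 by norm_num) (show (-1.1 : ℝ) ≤ -0.1 by norm_num) (show (-0.1 : ℝ) < 0 by norm_num)).umin * w /
                (4 + 2 * A))) +
          eps / ((bandBounds (show (-4 : ℝ) < -1.1 by norm_num) (show (-1.1 : ℝ) ≤ -0.1 by norm_num) (show (-0.1 : ℝ) < 0 by norm_num)).Dtmin - 2 * A) < pairSumLowerConst r * ϑC := by
  have hu := (bandBounds (show (-4 : ℝ) < -1.1 by norm_num) (show (-1.1 : ℝ) ≤ -0.1 by norm_num) (show (-0.1 : ℝ) < 0 by norm_num)).umin_pos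
  have hπ := Real.pi_pos
  have hP : 0 < pairSumLowerConst r * ϑC := mul_pos (pairSumLowerConst_pos hr) hϑC
  have hDt : 0 < (bandBounds (show (-4 : ℝ) < -1.1 by norm_num) (show (-1.1 : ℝ) ≤ -0.1 by norm_num) (show (-0.1 : ℝ) < 0 by norm_num)).Dtmin - 2 * A := by have := klCurveD_pos; linarith only [this, hd]
  obtain ⟨M, hM⟩ : ∃ M : ℝ, M = (2 * (bandBounds (show (-4 : ℝ) < -1.1 by norm_num) (show (-1.1 : ℝ) ≤ -0.1 by norm_num) (show (-0.1 : ℝ) < 0 by norm_num)).umin / π * ϑT) ^ 2 / 1000 := ⟨_, rfl⟩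
  have hM0 : 0 < M := by rw [hM]; positivity
  have hKc1 : 0 < Kc + 1 := by linarith
  obtain ⟨ℓ₀, L, Wm, Wφ, τ₀, Δ, Δc, ω, η₀, d₁, lam, eps, hi₀, ρC, Γ, Γ', f1, f2, f3, f4, f5, f6, f7, f8, f9, f10, f11, f12, f13, f14, f15, f16, f17, f18, f19, f20, f21, f22, f23, f24, f25, f26, f27, f28, f29, hrows⟩ :=
    exists_zoneThresholds_capped hA hA20 hd hr hlo hhi hA₃ hA₄ hK₁ hK₂ hK₃ hw hKc hK₀ hr₀ (τmax := min (pairSumLowerConst r * ϑC / 2) (M / (4 * (Kc + 1))))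
      (ρmax := min (M / 4) (1 / 10)) (lt_min (by positivity) (by positivity)) (lt_min (by positivity) (by norm_num))
  refine ⟨ℓ₀, L, Wm, Wφ, τ₀, Δ, Δc, ω, η₀, d₁, lam, eps, hi₀, ρC, Γ, Γ', f1, f2, f3, f4, f5, f6, f7, f8, f9, f10, f11, f12, f13, f14, f17, f18, f19, f20, f21, f22, f23, f24, f25, f26, f27, f28, f29,
    fun ℓ hi ρ Lw hℓ0 hℓ hhi0 hhi hρ hLw0 hLw => ?_⟩
  obtain ⟨r1, r2, r3, r4, r5, r6, r7, r8, r9, r10, r11, r12, r13, r14, r15, r16, r17⟩ := hrows ℓ hi ρ Lw hℓ0 hℓ hhi0 hhi hρ hLw0 hLw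
  refine ⟨r1, r2, r3, r4, r5, r6, r7, r8, r9, r10, r11, r12, r13, r14, r15, r16, r17, ?_, ?_⟩
  · -- the tangency margin: `|ρ| ≤ ρ_C ≤ min(M/4, 1/10)`, `K_cτ₀ ≤ K_c·M/(4(K_c+1)) ≤ M/4`
    have hρM : |ρ| ≤ M / 4 := hρ.trans (f16.trans (min_le_left _ _))
    have hρ10 : |ρ| ≤ 1 / 10 := hρ.trans (f16.trans (min_le_right _ _))
    have hsq : ρ ^ 2 ≤ |ρ| * (1 / 10) := by
      rw [← sq_abs, sq]; exact mul_le_mul_of_nonneg_left hρ10 (abs_nonneg ρ)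
    have hτ : Kc * τ₀ ≤ Kc * (M / (4 * (Kc + 1))) := mul_le_mul_of_nonneg_left (f15.trans (min_le_right _ _)) hKc
    have hq : Kc * (M / (4 * (Kc + 1))) ≤ M / 4 := by
      rw [show Kc * (M / (4 * (Kc + 1))) = M / 4 * (Kc / (Kc + 1)) by field_simp]
      have h2 : Kc / (Kc + 1) ≤ 1 := by rw [div_le_one hKc1]; linarith
      exact (mul_le_mul_of_nonneg_left h2 (by positivity)).trans (by linarith)
    have hMdef : (2 * (bandBounds (show (-4 : ℝ) < -1.1 by norm_num) (show (-1.1 : ℝ) ≤ -0.1 by norm_num) (show (-0.1 : ℝ) < 0 by norm_num)).umin / π * ϑT) ^ 2 = 1000 * M := by rw [hM]; ring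
    rw [hMdef]
    linarith only [hρM, hsq, hτ, hq, hM0]
  · -- the Cooper margin: `C(λ,ε) = T(λ,ε,hi) − 2hi/d ≤ τ₀ ≤ pairSumLowerConst r·ϑ_C/2`
    have hsplit : (2 * hi + eps) / ((bandBounds (show (-4 : ℝ) < -1.1 by norm_num) (show (-1.1 : ℝ) ≤ -0.1 by norm_num) (show (-0.1 : ℝ) < 0 by norm_num)).Dtmin - 2 * A) =
        2 * hi / ((bandBounds (show (-4 : ℝ) < -1.1 by norm_num) (show (-1.1 : ℝ) ≤ -0.1 by norm_num) (show (-0.1 : ℝ) < 0 by norm_num)).Dtmin - 2 * A) + eps / ((bandBounds (show (-4 : ℝ) < -1.1 by norm_num) (show (-1.1 : ℝ) ≤ -0.1 by norm_num) (show (-0.1 : ℝ) < 0 by norm_num)).Dtmin - 2 * A) := by ring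
    have h2 : 0 ≤ 2 * hi / ((bandBounds (show (-4 : ℝ) < -1.1 by norm_num) (show (-1.1 : ℝ) ≤ -0.1 by norm_num) (show (-0.1 : ℝ) < 0 by norm_num)).Dtmin - 2 * A) := by positivity
    have hτP : τ₀ ≤ pairSumLowerConst r * ϑC / 2 := f15.trans (min_le_left _ _)
    linarith only [r17, hsplit, h2, hτP, hP]

end Sizes

end Summit.HubbardSuperconductivity.HubbardSuperconductivity.Theorems.C4a

end
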